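import Literature.NumberTheory.Transcendental.WeakZPSchanuel
import Literature.NumberTheory.Transcendental.WeakZPLogPoint
import Literature.NumberTheory.Transcendental.WeakZPFibre
import Literature.NumberTheory.Transcendental.WeakCITCompactness
import Literature.NumberTheory.Transcendental.ZilberFieldGSGC
import HarnessLib

/-!
# Horizontal weak Zilber–Pink, step 4: the compactness step for a family, relative to an
ambient subtorus

Support file for the uniform horizontal weak Zilber–Pink theorem (Bays–Kirby 2018, Thm 11.4 /
Fact 11.3; Kirby 2009, Thm 4.3 "uniform Schanuel property" and Thm 4.6), the family/horizontal/
relative analogue of `WeakCIT.exists_int_relation_of_family` (`WeakCITCompactness.lean`).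

**Statement** (`WeakZP.exists_int_relation_of_familyG`). Let `L_k` (`k ∈ ℕ`) be two-block
logarithmic points (`WeakZP.LogPointG`, generic points `(u_k, y_k)` of irreducible
`X_k ⊆ 𝔾ₐ^{N'} × 𝔾ₘ^m`, logarithms `x_k`, Jacobian sets `S_{y,k}, S_{u,k}`). Suppose:
* (`H`) for a *fixed* integer unimodular `U_H` and rows `I_H`, the logarithms `(U_H x_k)_i`,
  `i ∈ I_H`, are constants (all `X_k` lie in cosets of the subtorus `H = (ker U_H^{I_H})°`);
* (`J`) for unimodular `V_k` (inverse `V'_k`) and rows `J_k`, `(V_k x_k)_i`, `i ∈ J_k`, are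
  constants (the coset relations, `|J_k| = rk`);
* (family) for complex parameters `b_k` and fixed polynomials `Φ ⊆ ℂ[b, u, y]`, the specialised
  `φ(b_k, ·)` lie in the prime `P_k` of `X_k` (`X_k ⊆ V_{b_k}`), and every prime `𝔮 ⊆ P_k` of
  `ℂ[u, y]` containing them has `dim ℂ[u, y] ⧸ 𝔮 ≤ d` (the components of `V_{b_k}` through `X_k`
  have dimension `≤ d`);
* (count) `d + |I_H| < |S_{y,k}| + |S_{u,k}| + |J_k|` for all `k` (atypicality relative to `H`).
Then there is an integer vector `r ≠ 0` supported off `I_H` such that, with `q = rᵀ U_H`, the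
Laurent monomial `y_k^q` is killed by all derivations of `L_k` for infinitely many `k`.

**Proof.** A non-principal ultrafilter `𝒰` on `ℕ` and the ultraproduct `F* = Π_𝒰 F_k` with the
componentwise derivations (`WeakCITUltraproduct.lean`); by pigeonhole the shapes
`(S_{y,k}, S_{u,k}, J_k)` are constant on a set `A₀ ∈ 𝒰`. All hypotheses of the one-field bound
`WeakZP.exists_int_relation_rel` transfer to `F*` by Łoś; the certificate
`relRank (ℂ ∪ b*) (u* ∪ y*) ≤ d` is `WeakZP.exists_generic_fibre_certificate` at the point
`(b*, u*, y*)`, whose three specialisation conditions hold at `b_k` for `𝒰`-almost all `k`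
(Łoś for finitely many polynomial (in)equations). The integer relation obtained in `F*` is
transferred back by Łoś.

## References

* J. Kirby, *The theory of the exponential differential equations of semiabelian varieties*,
  Selecta Math. 15 (2009), Thm 4.3, Thm 4.6.
* M. Bays, J. Kirby, *Pseudo-exponential maps, variants, and quasiminimality*, ANT 12 (2018),
  Fact 11.3, Thm 11.4.
-/

noncomputable section

open MvPolynomial Set Filter

namespace Literature.NumberTheory.Transcendental.WeakZP

open WeakCIT GammaField Matroid

variable {N' m : ℕ}

/-- The prime of a two-block logarithmic point is prime (it is the ideal of a point of a field).
[folklore] -/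
theorem LogPointG.isPrime_P (L : LogPointG N' m) : L.P.IsPrime := by
  have : L.P = RingHom.ker (aeval (Sum.elim L.u L.y) : MvPolynomial (Fin N' ⊕ Fin m) ℂ →ₐ[ℂ] L.F) := by
    ext g; rw [RingHom.mem_ker, L.aeval_eq_zero_iff]
  rw [this]
  exact RingHom.ker_isPrime _

/-- **Relative rank over a generated subfield, from a transcendence degree** (adapter between the
certificate of `WeakZP.exists_generic_fibre_certificate` and the hypothesis of
`WeakZP.exists_int_relation_rel`): for `k₁ = ℂ(Z) ⊆ E` and `T ⊆ E`, a bound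
`trdeg_{k₁} k₁[T] ≤ d` bounds the relative rank of `T` over `ℂ ∪ Z` in the algebraic matroid of
`E/ℚ`. [folklore] -/
theorem relRank_le_of_trdeg_adjoin_le {E : Type} [Field E] [CharZero E] [Algebra ℂ E] (Z T : Set E)
    {d : ℕ}
    (h : Algebra.trdeg (IntermediateField.adjoin ℂ Z) (Algebra.adjoin (IntermediateField.adjoin ℂ Z) T) ≤ d) :
    (algMatroid E).relRank (Set.range (algebraMap ℂ E) ∪ Z) T ≤ d := by
  set k₁ : IntermediateField ℂ E := IntermediateField.adjoin ℂ Z with hk₁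
  have h1 : (algMatroid E).relRank (k₁.toSubfield : Set E) T ≤ d :=
    ZilberGSGC.relRank_le_of_trdeg_le k₁.toSubfield T h
  -- `ℂ ∪ Z ⊆ k₁ ⊆ closure (ℂ ∪ Z)`
  have hsub : (k₁.toSubfield : Set E) ⊆ (algMatroid E).closure (Set.range (algebraMap ℂ E) ∪ Z) := by
    intro z hz
    have hz' : z ∈ Subfield.closure (Set.range (algebraMap ℂ E) ∪ Z) := by
      have : k₁.toSubfield = Subfield.closure (Set.range (algebraMap ℂ E) ∪ Z) := by
        rw [hk₁, IntermediateField.adjoin_toSubfield]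
      rw [← this]; exact hz
    exact subfieldClosure_subset_acl _ hz'
  calc (algMatroid E).relRank (Set.range (algebraMap ℂ E) ∪ Z) T
      = (algMatroid E).relRank ((algMatroid E).closure (Set.range (algebraMap ℂ E) ∪ Z)) T :=
        ((algMatroid E).relRank_closure_left _ _).symm
    _ ≤ (algMatroid E).relRank (k₁.toSubfield : Set E) T := (algMatroid E).relRank_anti_left _ hsub
    _ ≤ d := h1

/-- **The compactness step, for a family and relative to an ambient subtorus** (see the module
docstring). [cite: Kirby2009, Thm 4.3 and Thm 4.6 (proof)] [cite: BaysKirby2018ANT, Thm 11.4] -/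
theorem exists_int_relation_of_familyG (L : ℕ → LogPointG N' m)
    (UH UH' : Matrix (Fin m) (Fin m) ℤ) (hU'U : UH' * UH = 1) (IH : Finset (Fin m))
    (hH : ∀ k, ∀ i ∈ IH, ∀ j, (L k).D j (∑ l, (UH i l : (L k).F) * (L k).x l) = 0)
    (V V' : ℕ → Matrix (Fin m) (Fin m) ℤ) (hV'V : ∀ k, V' k * V k = 1) (J : ℕ → Finset (Fin m))
    (hJrel : ∀ k, ∀ i ∈ J k, ∀ j, (L k).D j (∑ l, (V k i l : (L k).F) * (L k).x l) = 0)
    {p : ℕ} (Φ : Finset (MvPolynomial (Fin p ⊕ (Fin N' ⊕ Fin m)) ℂ)) (b : ℕ → Fin p → ℂ)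
    (hΦ : ∀ k, ∀ φ ∈ Φ, spec (b k) φ ∈ (L k).P) (d : ℕ)
    (hdim : ∀ k, ∀ 𝔮 : Ideal (MvPolynomial (Fin N' ⊕ Fin m) ℂ), 𝔮.IsPrime → 𝔮 ≤ (L k).P →
      (∀ φ ∈ Φ, spec (b k) φ ∈ 𝔮) → ringKrullDim (MvPolynomial (Fin N' ⊕ Fin m) ℂ ⧸ 𝔮) ≤ d)
    (hlt : ∀ k, d + IH.card < (L k).Sy.card + (L k).Su.card + (J k).card) :
    ∃ r : Fin m → ℤ, r ≠ 0 ∧ (∀ i ∈ IH, r i = 0) ∧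
      ∀ N : ℕ, ∃ k, N ≤ k ∧ ∀ j, (L k).D j (∏ l, (L k).y l ^ (∑ i, r i * UH i l)) = 0 := by
  classical
  -- a non-principal ultrafilter and the pigeonhole on the shapes `(S_y, S_u, J)`
  set 𝒰 : Ultrafilter ℕ := hyperfilter ℕ with h𝒰
  obtain ⟨⟨S₀y, S₀u, J₀⟩, -, hA₀⟩ := (Ultrafilter.finite_biUnion_mem_iff (f := 𝒰)
    (is := (Set.univ : Set (Finset (Fin m) × Finset (Fin N') × Finset (Fin m))))
    (s := fun t => {k | (L k).Sy = t.1 ∧ (L k).Su = t.2.1 ∧ J k = t.2.2}) Set.finite_univ).mp (by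
      have : (⋃ t ∈ (Set.univ : Set (Finset (Fin m) × Finset (Fin N') × Finset (Fin m))),
          {k | (L k).Sy = t.1 ∧ (L k).Su = t.2.1 ∧ J k = t.2.2}) = Set.univ := by
        ext k
        simp only [Set.mem_iUnion, Set.mem_univ, Set.mem_setOf_eq, exists_prop, true_and, iff_true]
        exact ⟨((L k).Sy, (L k).Su, J k), rfl, rfl, rfl⟩
      rw [this]
      exact univ_mem)
  -- the ultraproduct and the transferred data
  let Fam : ℕ → Type := fun k => (L k).F
  let Fs : Type := Ultraproduct Fam 𝒰
  let us : Fin N' → Fs := fun s => mk Fam 𝒰 fun k => (L k).u s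
  let xs : Fin m → Fs := fun i => mk Fam 𝒰 fun k => (L k).x i
  let ys : Fin m → Fs := fun i => mk Fam 𝒰 fun k => (L k).y i
  let x's : Fin m → Fs := fun i => mk Fam 𝒰 fun k => ∑ l, (V k i l : (L k).F) * (L k).x l
  let V's : Matrix (Fin m) (Fin m) Fs := Matrix.of fun i l => mk Fam 𝒰 fun k => (V' k i l : (L k).F)
  let bs : Fin p → Fs := fun l => mk Fam 𝒰 fun k => algebraMap ℂ (L k).F (b k l)
  let Ds : Fin (N' + m) → Derivation ℤ Fs Fs := fun j =>
    WeakCIT.liftDerivation (F := Fam) (U := 𝒰) fun k => ((L k).D j).restrictScalars ℤ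
  have hDs_mk : ∀ j (f : ∀ k, Fam k), Ds j (mk Fam 𝒰 f) = mk Fam 𝒰 fun k => (L k).D j (f k) :=
    fun j f => rfl
  have hcastD : ∀ k j (z : ℤ), (L k).D j (z : (L k).F) = 0 := fun k j z => by
    rw [← map_intCast (algebraMap ℂ (L k).F) z]
    exact Derivation.map_algebraMap _ _
  have hmk_int : ∀ z : ℤ, (z : Fs) = mk Fam 𝒰 fun k => (z : (L k).F) := fun z =>
    (map_intCast (mk Fam 𝒰) z).symm
  -- hypotheses of the one-field bound
  have hy : ∀ i, ys i ≠ 0 := fun i => by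
    show mk Fam 𝒰 (fun k => (L k).y i) ≠ 0
    rw [WeakCIT.mk_ne_zero_iff]
    exact Eventually.of_forall fun k => (L k).y_ne_zero i
  have hexp : ∀ j i, Ds j (ys i) = ys i * Ds j (xs i) := fun j i => by
    show Ds j (mk Fam 𝒰 fun k => (L k).y i) =
      mk Fam 𝒰 (fun k => (L k).y i) * Ds j (mk Fam 𝒰 fun k => (L k).x i)
    rw [hDs_mk, hDs_mk, ← map_mul]
    congr 1
    funext k
    exact (L k).map_y j i
  have hV' : ∀ j i l, Ds j (V's i l) = 0 := fun j i l => by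
    show Ds j (mk Fam 𝒰 fun k => (V' k i l : (L k).F)) = 0
    rw [hDs_mk, WeakCIT.mk_eq_zero_iff]
    exact Eventually.of_forall fun k => hcastD k j _
  have hx : ∀ i, xs i = ∑ l, V's i l * x's l := fun i => by
    show xs i = ∑ l, mk Fam 𝒰 (fun k => (V' k i l : (L k).F)) *
      mk Fam 𝒰 (fun k => ∑ l', (V k l l' : (L k).F) * (L k).x l')
    rw [WeakCIT.sum_mk_mul_mk]
    show mk Fam 𝒰 (fun k => (L k).x i) = _
    congr 1
    funext k
    exact (sum_cast_mul_sum_cast_mul (hV'V k) (L k).x i).symm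
  have hJ : ∀ i ∈ J₀, ∀ j, Ds j (x's i) = 0 := fun i hi j => by
    show Ds j (mk Fam 𝒰 fun k => ∑ l, (V k i l : (L k).F) * (L k).x l) = 0
    rw [hDs_mk, WeakCIT.mk_eq_zero_iff]
    refine mem_of_superset hA₀ fun k hk => ?_
    exact hJrel k i (hk.2.2 ▸ hi) j
  have hIH : ∀ i ∈ IH, ∀ j, Ds j (∑ l, (UH i l : Fs) * xs l) = 0 := fun i hi j => by
    have : (∑ l, (UH i l : Fs) * xs l) = mk Fam 𝒰 fun k => ∑ l, (UH i l : (L k).F) * (L k).x l := by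
      show (∑ l, (UH i l : Fs) * mk Fam 𝒰 (fun k => (L k).x l)) = _
      simp only [hmk_int]
      exact WeakCIT.sum_mk_mul_mk (fun k l => (UH i l : (L k).F)) (fun k l => (L k).x l)
    rw [this, hDs_mk, WeakCIT.mk_eq_zero_iff]
    exact Eventually.of_forall fun k => hH k i hi j
  have hsingle : ∀ (c : Fin (N' + m)) (j : Fin (N' + m)),
      (Pi.single c (1 : Fs) : Fin (N' + m) → Fs) j =
        mk Fam 𝒰 fun k => (Pi.single c (1 : (L k).F) : Fin (N' + m) → (L k).F) j := by
    intro c j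
    by_cases h : j = c
    · subst h; simp only [Pi.single_eq_same]; exact (map_one (mk Fam 𝒰)).symm
    · simp only [Pi.single_eq_of_ne h]; exact (map_zero (mk Fam 𝒰)).symm
  have hSy : ∀ i ∈ S₀y, ∀ j, Ds j (xs i) =
      (Pi.single (finSumFinEquiv (Sum.inr i)) (1 : Fs) : _ → Fs) j := fun i hi j => by
    show Ds j (mk Fam 𝒰 fun k => (L k).x i) = _
    rw [hDs_mk, hsingle, WeakCIT.mk_eq_mk_iff]
    refine mem_of_superset hA₀ fun k hk => ?_
    exact (L k).map_x i (hk.1 ▸ hi) j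
  have hSu : ∀ s ∈ S₀u, ∀ j, Ds j (us s) =
      (Pi.single (finSumFinEquiv (Sum.inl s)) (1 : Fs) : _ → Fs) j := fun s hs j => by
    show Ds j (mk Fam 𝒰 fun k => (L k).u s) = _
    rw [hDs_mk, hsingle, WeakCIT.mk_eq_mk_iff]
    refine mem_of_superset hA₀ fun k hk => ?_
    exact (L k).map_u s (hk.2.1 ▸ hs) j
  have hSu_y : ∀ s ∈ S₀u, ∀ i, Ds (finSumFinEquiv (Sum.inl s)) (ys i) = 0 := fun s hs i => by
    show Ds _ (mk Fam 𝒰 fun k => (L k).y i) = 0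
    rw [hDs_mk, WeakCIT.mk_eq_zero_iff]
    refine mem_of_superset hA₀ fun k hk => ?_
    exact (L k).map_u_y s (hk.2.1 ▸ hs) i
  -- the certificate `relRank (ℂ ∪ b*) (u* ∪ y*) ≤ d`
  have halg : ∀ c : ℂ, algebraMap ℂ Fs c = mk Fam 𝒰 (fun k => algebraMap ℂ (L k).F c) :=
    fun c => WeakCIT.algebraMap_eq_mk c
  set k' : Set Fs := Set.range (algebraMap ℂ Fs) ∪ Set.range bs with hk'
  have hk'D : ∀ z ∈ k', ∀ j, Ds j z = 0 := by
    rintro z (⟨c, rfl⟩ | ⟨l, rfl⟩) j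
    · rw [halg, hDs_mk, WeakCIT.mk_eq_zero_iff]
      exact Eventually.of_forall fun k => Derivation.map_algebraMap _ c
    · show Ds j (mk Fam 𝒰 fun k => algebraMap ℂ (L k).F (b k l)) = 0
      rw [hDs_mk, WeakCIT.mk_eq_zero_iff]
      exact Eventually.of_forall fun k => Derivation.map_algebraMap _ _
  let ptk : ∀ k, Fin p ⊕ (Fin N' ⊕ Fin m) → (L k).F := fun k =>
    Sum.elim (fun l => algebraMap ℂ (L k).F (b k l)) (Sum.elim (L k).u (L k).y)
  let ptS : Fin p ⊕ (Fin N' ⊕ Fin m) → Fs := Sum.elim bs (Sum.elim us ys)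
  have hptS : ptS = fun c => mk Fam 𝒰 fun k => ptk k c := by
    funext c; rcases c with l | (s | i) <;> rfl
  have hptk : ∀ k (g : MvPolynomial (Fin p ⊕ (Fin N' ⊕ Fin m)) ℂ),
      aeval (ptk k) g = aeval (Sum.elim (L k).u (L k).y) (spec (b k) g) := fun k g => by
    rw [aeval_spec]
  have hΦS : ∀ φ ∈ Φ, aeval ptS φ = 0 := fun φ hφ => by
    rw [hptS, WeakCIT.aeval_mk, WeakCIT.mk_eq_zero_iff]
    exact Eventually.of_forall fun k => by
      rw [hptk, (L k).aeval_eq_zero_iff]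
      exact hΦ k φ hφ
  obtain ⟨f₀, G, G', r, hf, hG, hG', htr, hspec⟩ := exists_generic_fibre_certificate ptS Φ hΦS
  -- the three specialisation conditions hold at `b_k` for `𝒰`-almost all `k`
  have hbs : ptS ∘ Sum.inl = bs := by funext l; rfl
  have haeval_bs : ∀ g : MvPolynomial (Fin p) ℂ,
      aeval bs g = mk Fam 𝒰 (fun k => algebraMap ℂ (L k).F (aeval (b k) g)) := fun g => by
    show aeval (fun l => mk Fam 𝒰 fun k => algebraMap ℂ (L k).F (b k l)) g = _
    rw [WeakCIT.aeval_mk]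
    congr 1
    funext k
    exact aeval_algebraMap_apply (L k).F (b k) g
  have hev1 : ∀ᶠ k in (𝒰 : Filter ℕ), aeval (b k) f₀ ≠ 0 := by
    rw [hbs, haeval_bs, WeakCIT.mk_ne_zero_iff] at hf
    exact hf.mono fun k hk h => hk (by rw [h, map_zero])
  have hev2 : ∀ᶠ k in (𝒰 : Filter ℕ), ∀ g ∈ G, spec (b k) g ∈ (L k).P := by
    rw [eventually_all_finset]
    intro g hg
    have h := hG g hg
    rw [hptS, WeakCIT.aeval_mk, WeakCIT.mk_eq_zero_iff] at h
    exact h.mono fun k hk => by rwa [hptk, (L k).aeval_eq_zero_iff] at hk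
  have hev3 : ∀ᶠ k in (𝒰 : Filter ℕ), ∀ g ∈ G', aeval (b k) g = 0 := by
    rw [eventually_all_finset]
    intro g hg
    have h := hG' g hg
    rw [hbs, haeval_bs, WeakCIT.mk_eq_zero_iff] at h
    exact h.mono fun k hk => (algebraMap ℂ (L k).F).injective (by rw [hk, map_zero])
  obtain ⟨k₁, hk₁1, hk₁2, hk₁3⟩ := 𝒰.nonempty_of_mem (inter_mem hev1 (inter_mem hev2 hev3))
  have hrd : r ≤ d :=
    hspec (b k₁) (L k₁).P (L k₁).isPrime_P hk₁1 hk₁2 hk₁3 d (hdim k₁)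
  have hd : (algMatroid Fs).relRank k' (Set.range us ∪ Set.range ys) ≤ d := by
    have hrange : Set.range (ptS ∘ Sum.inr) = Set.range us ∪ Set.range ys := by
      show Set.range (Sum.elim us ys) = _
      exact Set.Sum.elim_range _ _
    rw [hrange, hbs] at htr
    have hrd' : (r : Cardinal) ≤ (d : Cardinal) := by exact_mod_cast hrd
    exact relRank_le_of_trdeg_adjoin_le (E := Fs) (Set.range bs) (Set.range us ∪ Set.range ys)
      (htr.trans hrd')
  -- the count at a point of `A₀`
  obtain ⟨k₀, hk₀⟩ := 𝒰.nonempty_of_mem hA₀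
  have hlt₀ : d + IH.card < S₀y.card + S₀u.card + J₀.card := by
    have := hlt k₀
    rw [hk₀.1, hk₀.2.1, hk₀.2.2] at this
    exact this
  -- the one-field Schanuel bound in the ultraproduct
  obtain ⟨rr, hrr0, hrrIH, hrr⟩ := exists_int_relation_rel Ds us xs ys x's hy hexp V's hV' hx J₀ hJ
    UH UH' hU'U IH hIH S₀y hSy S₀u hSu hSu_y k' hk'D hd hlt₀
  refine ⟨rr, hrr0, hrrIH, fun N => ?_⟩
  -- transfer back
  set q : Fin m → ℤ := fun l => ∑ i, rr i * UH i l with hq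
  have hsumq : (∑ i, (rr i : Fs) * ∑ l, (UH i l : Fs) * xs l) = ∑ l, (q l : Fs) * xs l := by
    calc (∑ i, (rr i : Fs) * ∑ l, (UH i l : Fs) * xs l)
        = ∑ i, ∑ l, (rr i : Fs) * ((UH i l : Fs) * xs l) := by
          refine Finset.sum_congr rfl fun i _ => ?_
          rw [Finset.mul_sum]
      _ = ∑ l, ∑ i, (rr i : Fs) * ((UH i l : Fs) * xs l) := Finset.sum_comm
      _ = ∑ l, (q l : Fs) * xs l := by
          refine Finset.sum_congr rfl fun l _ => ?_
          show _ = ((∑ i, rr i * UH i l : ℤ) : Fs) * xs l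
          rw [Int.cast_sum, Finset.sum_mul]
          refine Finset.sum_congr rfl fun i _ => ?_
          rw [Int.cast_mul, mul_assoc]
  have hprod : ∀ j, Ds j (∏ l, ys l ^ q l) = 0 := fun j => by
    have h1 := derivation_prod_zpow (Ds j) xs ys hy (fun l => hexp j l) q
    rw [← hsumq, hrr j, mul_zero] at h1
    exact h1
  have hev : ∀ᶠ k in (𝒰 : Filter ℕ), ∀ j, (L k).D j (∏ l, (L k).y l ^ q l) = 0 := by
    have h := (WeakCIT.forall_liftDerivation_mk_eq_zero_iff (F := Fam) (U := 𝒰)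
      (fun k j => ((L k).D j).restrictScalars ℤ) (fun k => ∏ l, (L k).y l ^ q l)).mp (fun j => by
        have := hprod j
        rwa [show (∏ l, ys l ^ q l) = mk Fam 𝒰 (fun k => ∏ l, (L k).y l ^ q l) from
          WeakCIT.prod_mk_zpow (F := Fam) (U := 𝒰) (fun k l => (L k).y l) q] at this)
    exact h.mono fun k hk j => hk j
  have hN : ∀ᶠ k in (𝒰 : Filter ℕ), N ≤ k :=
    (hyperfilter_le_cofinite.trans_eq Nat.cofinite_eq_atTop) (eventually_ge_atTop N)
  obtain ⟨k, hk, hkN⟩ := 𝒰.nonempty_of_mem (inter_mem hev hN)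
  exact ⟨k, hkN, hk⟩

end Literature.NumberTheory.Transcendental.WeakZP
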